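import Mathlib
import HarnessLib
import Summits.ValiantsHypothesis.ValiantsHypothesis.Theorems.LacunarySymmetroidMatrixDescartesOsculationLawPeelBranchArc
import Summits.ValiantsHypothesis.ValiantsHypothesis.Theorems.LacunarySymmetroidMatrixDescartesOsculationLawPeelRankTwoEvents
import Summits.ValiantsHypothesis.ValiantsHypothesis.Theorems.LacunarySymmetroidMatrixDescartesOsculationLawPeelRankTwoBranchArc

/-!
# ValiantsHypothesis / LacunarySymmetroid — crux `MatrixDescartes` (stmt-ValiantsHypothesis-18050, V1),
# line `Cruxes/MatrixDescartes/Lines/osculation_law.lean` («osculation-law»), stub `stub_peel` at RANK TWO: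
# AT MOST TWO MEETING POINTS PER OWN-CUT-FREE ARC (step (B5a) of HOME/lmr/NOTE-p7g12-peel-r2-plan.md)

The branch-arc engine (`OsculationPeel.card_roots_filter_branchArc_le_two`, every rank) fed with the rank-two
branch `β_σ` (files `…PeelRankTwoBranchFormulas`, `…PeelRankTwoBranchArc`) and the consequences of hyperbolicity
(`…PeelRankTwoEvents`):

* `branch_arc_count_two` — for `Φ = X₁X₁·ι a + X₁·ι e + ι f` hyperbolic (`4af ≤ e²`), `g(t) = Φ(t, c t^N)`, `c > 0`,
  the general-position clause "`∂_bΦ ≠ 0` at every osculation point", and an open arc `(L, U)`, `L ≥ 0`, on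
  which branch `σ` neither escapes nor vanishes nor carries an osculation point: **the roots of `g` in `(L, U)`
  lying on branch `σ`, counted with multiplicity, are at most two.**

What remains for `PeelInequality` at `r = 2` ((B5b)/(B5c) of the memo): the assignment of the positive roots of
`g` to the two branches, the three cut finsets per branch with their counting inequalities, the pigeonhole
`card_le_mul_card_cuts_succ` twice, and the unfolding to the line's verbatim statement.  Honest framing:
bookkeeping for an OPEN stub; nothing here bears on `stub_peel`, the LAW, `MatrixDescartes` or `VP ≠ VNP`.
No definitions, no named facts.
-/

-- `Summit.ValiantsHypothesis.ValiantsHypothesis.…` is the tree's mandated single-conjunct layout (Sub = Summit).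
set_option linter.dupNamespace false

noncomputable section

namespace Summit.ValiantsHypothesis.ValiantsHypothesis.Theorems.LacunarySymmetroidMatrixDescartes

open Polynomial Set
open scoped BigOperators Topology

namespace OsculationPeel

/-- **At most two meeting points (with multiplicity) on an own-cut-free arc of branch `σ`**, rank two. [folklore] -/
theorem branch_arc_count_two (a e f : ℝ[X]) (σ : ℝ) (β : ℝ → ℝ)
    (hβ : ∀ t, β t = if a.eval t = 0 then -f.eval t / e.eval t
      else (-e.eval t + σ * Real.sqrt (e.eval t ^ 2 - 4 * a.eval t * f.eval t)) / (2 * a.eval t))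
    (ha0 : a ≠ 0) (hΔ : ∀ t, 4 * a.eval t * f.eval t ≤ e.eval t ^ 2) (hσ : σ = 1 ∨ σ = -1)
    (c : ℝ) (N : ℕ) (hc : 0 < c) (Φ : MvPolynomial (Fin 2) ℝ)
    (hΦ : Φ = MvPolynomial.X 1 * MvPolynomial.X 1 * Polynomial.aeval (MvPolynomial.X 0 : MvPolynomial (Fin 2) ℝ) a
        + MvPolynomial.X 1 * Polynomial.aeval (MvPolynomial.X 0 : MvPolynomial (Fin 2) ℝ) e
        + Polynomial.aeval (MvPolynomial.X 0 : MvPolynomial (Fin 2) ℝ) f)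
    (g : ℝ[X]) (hg : ∀ t, g.eval t = MvPolynomial.eval ![t, c * t ^ N] Φ)
    (hgp : ∀ p ∈ {p : Fin 2 → ℝ | 0 < p 0 ∧ 0 < p 1 ∧ MvPolynomial.eval p Φ = 0 ∧
      MvPolynomial.eval p
        (MvPolynomial.X 0 * MvPolynomial.pderiv 0 (MvPolynomial.X 0 * MvPolynomial.pderiv 0 Φ)
            * (MvPolynomial.X 1 * MvPolynomial.pderiv 1 Φ) ^ 2
          - 2 * (MvPolynomial.X 0 * MvPolynomial.pderiv 0 (MvPolynomial.X 1 * MvPolynomial.pderiv 1 Φ))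
            * (MvPolynomial.X 0 * MvPolynomial.pderiv 0 Φ) * (MvPolynomial.X 1 * MvPolynomial.pderiv 1 Φ)
          + MvPolynomial.X 1 * MvPolynomial.pderiv 1 (MvPolynomial.X 1 * MvPolynomial.pderiv 1 Φ)
            * (MvPolynomial.X 0 * MvPolynomial.pderiv 0 Φ) ^ 2) = 0},
        MvPolynomial.eval p (MvPolynomial.pderiv 1 Φ) ≠ 0)
    {L U : ℝ} (hL : 0 ≤ L)
    (hesc : ∀ t, L < t → t < U → a.eval t ≠ 0 ∨ 0 < σ * e.eval t)
    (hzero : ∀ t, L < t → t < U → f.eval t = 0 → σ * e.eval t < 0)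
    (hosc : ∀ t, L < t → t < U → 0 < β t → ![t, β t] ∉ {p : Fin 2 → ℝ | 0 < p 0 ∧ 0 < p 1 ∧ MvPolynomial.eval p Φ = 0 ∧
      MvPolynomial.eval p
        (MvPolynomial.X 0 * MvPolynomial.pderiv 0 (MvPolynomial.X 0 * MvPolynomial.pderiv 0 Φ)
            * (MvPolynomial.X 1 * MvPolynomial.pderiv 1 Φ) ^ 2
          - 2 * (MvPolynomial.X 0 * MvPolynomial.pderiv 0 (MvPolynomial.X 1 * MvPolynomial.pderiv 1 Φ))
            * (MvPolynomial.X 0 * MvPolynomial.pderiv 0 Φ) * (MvPolynomial.X 1 * MvPolynomial.pderiv 1 Φ)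
          + MvPolynomial.X 1 * MvPolynomial.pderiv 1 (MvPolynomial.X 1 * MvPolynomial.pderiv 1 Φ)
            * (MvPolynomial.X 0 * MvPolynomial.pderiv 0 Φ) ^ 2) = 0}) :
    Multiset.card (g.roots.filter (fun t => L < t ∧ t < U ∧ β t = c * t ^ N)) ≤ 2 := by
  classical
  set M := g.roots.filter (fun t => L < t ∧ t < U ∧ β t = c * t ^ N) with hM
  by_cases hM0 : M = 0
  · rw [hM0]; simp
  -- a meeting point `t₀` on the arc: the branch is positive there
  obtain ⟨t₀, ht₀M⟩ := Multiset.exists_mem_of_ne_zero hM0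
  have ht₀ : L < t₀ ∧ t₀ < U ∧ β t₀ = c * t₀ ^ N := (Multiset.mem_filter.1 ht₀M).2
  have hpos₀ : 0 < β t₀ := by rw [ht₀.2.2]; exact mul_pos hc (pow_pos (hL.trans_lt ht₀.1) N)
  -- positivity, no double root, `Δ > 0`, smoothness on the arc
  have hposI := branch_pos a e f σ β hβ ha0 hΔ hσ hesc hzero ht₀.1 ht₀.2.1 hpos₀
  have hnd : ∀ t, L < t → t < U → ∀ b : ℝ, 0 < b →
      a.eval t * b ^ 2 + e.eval t * b + f.eval t = 0 → 2 * a.eval t * b + e.eval t = 0 → False := by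
    intro t h1 h2 b hb hroot hder
    by_cases ha : a.eval t = 0
    · rw [ha, mul_zero, zero_mul, zero_add] at hder
      rcases hesc t h1 h2 with h | h
      · exact h ha
      · rw [hder, mul_zero] at h; exact lt_irrefl _ h
    · exact false_of_double_root a e f hΔ Φ hΦ hgp (hL.trans_lt h1) hb ha hroot hder
  have hΔI : ∀ t, L < t → t < U → a.eval t ≠ 0 → 0 < e.eval t ^ 2 - 4 * a.eval t * f.eval t :=
    fun t h1 h2 ha => branch_discr_pos a e f σ β hβ hΔ hσ (hnd t h1 h2) ha (hposI t h1 h2)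
  have hC : ∀ t, L < t → t < U → ContDiffAt ℝ ⊤ β t :=
    fun t h1 h2 => branch_contDiffAt a e f σ β hβ ha0 hΔ hσ (hesc t h1 h2) (hΔI t h1 h2)
  have hD := fun t (h1 : L < t) (h2 : t < U) => hasDerivAt_of_contDiffAt β hC h1 h2
  -- the engine
  refine card_roots_filter_branchArc_le_two Φ g c N hL β (deriv β) (deriv (deriv β)) hg
    (fun s hs => (hD s hs.1 hs.2).1) (fun s hs => (hD s hs.1 hs.2).2) (fun s hs => hposI s hs.1 hs.2)
    (fun s hs => ?_) (fun s hs => ?_) (fun s hs => ?_)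
  · -- `Φ(s, β s) = 0`
    have hroot := branch_root a e f σ β hβ hΔ hσ (hesc s hs.1 hs.2)
    rw [hΦ, eval_Phi₂]
    simp only [Matrix.cons_val_one, Matrix.cons_val_zero]
    linear_combination hroot
  · -- `∂_bΦ(s, β s) ≠ 0`
    have hne := branch_two_mul_add_ne a e f σ β hβ hσ (hesc s hs.1 hs.2) (hΔI s hs.1 hs.2)
    rw [hΦ, eval_pderiv_one_Phi₂]
    simp only [Matrix.cons_val_one, Matrix.cons_val_zero]
    intro h0; apply hne; linear_combination h0
  · -- `H(Φ)(s, β s) ≠ 0`: otherwise an own osculation point on the arc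
    intro hH
    refine hosc s hs.1 hs.2 (hposI s hs.1 hs.2) ⟨?_, ?_, ?_, hH⟩
    · simpa [Matrix.cons_val_zero] using hL.trans_lt hs.1
    · simpa [Matrix.cons_val_one] using hposI s hs.1 hs.2
    · have hroot := branch_root a e f σ β hβ hΔ hσ (hesc s hs.1 hs.2)
      rw [hΦ, eval_Phi₂]
      simp only [Matrix.cons_val_one, Matrix.cons_val_zero]
      linear_combination hroot

end OsculationPeel

end Summit.ValiantsHypothesis.ValiantsHypothesis.Theorems.LacunarySymmetroidMatrixDescartes

end
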